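import Summits.QuantumFields.GaugeBoot.BootstrapReflectionCutConsistency
import HarnessLib

/-!
# The reflection-positivity BLOCKS of a lattice bootstrap are positive semi-definite Hermitian
# matrices for every solution (gauge-boot, L3 ↔ L1)

HONEST FRAMING (cell `pub-gaugeboot`, page 1 of every file): the venture produces certified bounds
on lattice expectations at stated coupling, gauge group, dimension and torus size; NOT a mass gap,
NOT a continuum limit, NOT a string tension; NOT Yang–Mills-summit-bearing (barriers
`FixedCouplingUltralocality`, `PerturbativeInvisibility`). Structural; it certifies no number.

## Content

In a lattice SDP (Anderson–Kruczenski §3, Kazakov–Zheng §4) a reflection cut family is imposed as a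
POSITIVE SEMI-DEFINITE HERMITIAN MATRIX: for complex test functions `F_a` (Wilson lines / loops of
the closed half, `a` in a finite index set) the block `B_{ab} = φ((F_a ∘ Θ)‾ · F_b)`. The modules
`BootstrapReflectionCutConsistency` … state the cuts as the scalar inequalities `0 ≤ φ((v∘Θ) · v)`
for REAL test functions `v`. This module records that the two forms agree for a solution `φ` of the
torus bootstrap, for an arbitrary reflection `Θ` and link set `S`:

* ★ `ReflectionPositiveOn.sum_conj_mul_integral_nonneg` — if `μ` is RP for `(Θ, S)`, then for bounded
  measurable complex `S`-supported `F_a` and `c ∈ ℂ^κ`: `0 ≤ ∑_{a,b} c̄_a c_b ∫ (F_a∘Θ)‾ F_b dμ`;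
* `rpBlock φ Θ u v` — the complex block of a real-linear functional `φ` on the complex test functions
  `F_a = u_a + i v_a` (`u_a, v_a` real): entries
  `φ((u_a∘Θ)u_b) + φ((v_a∘Θ)v_b) + i (φ((u_a∘Θ)v_b) - φ((v_a∘Θ)u_b))`;
* ★★ `rpCutGram_nonneg_of_bootstrap_suN` — REAL Gram form: the matrices `(φ((u_j∘Θ) u_k))_{jk}` are
  positive semi-definite on real vectors for every solution (`u_j` polynomial, `S`-supported);
* ★★★ `rpBlock_quadForm_nonneg_of_bootstrap_suN`, `rpBlock_posSemidef_of_bootstrap_suN` — COMPLEX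
  form: for every solution `φ` of the untruncated `SU(N)` torus bootstrap (Wilson measure RP for
  `(Θ, S)`, `Θ` a `μ_W`-preserving polynomial-stable involution) the block `rpBlock φ Θ u v` on
  polynomial `S`-supported `u_a, v_a` is a positive semi-definite Hermitian matrix
  (`Matrix.PosSemidef`) — the constraint exactly as an SDP imposes it.

References: P. D. Anderson, M. Kruczenski, Nucl. Phys. B 921 (2017) 702 §3; V. Kazakov, Z. Zheng,
arXiv:2203.11360 §4. Folklore-level.
-/

noncomputable section

open MeasureTheory Filter Topology NormedSpace
open scoped ComplexOrder ComplexConjugate Matrix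
open Literature.MathematicalPhysics.QuantumFieldTheory (LatticeRep Site Edge GaugeConfig wilsonAction wilsonMeasure
  isProbabilityMeasure_wilsonMeasure)

namespace Summit.QuantumFields.GaugeBoot

/-! ## Complex blocks from reflection positivity of a measure -/

section Measure

variable {d L : ℕ} {G : Type*} [MeasurableSpace G]

/-- ★ **The complex RP blocks of an RP measure are positive semi-definite**: `μ` RP for `(Θ, S)` (`Θ`
measurable), `F_a` bounded measurable complex with `DependsOn F_a S`, `c ∈ ℂ^κ`:
`0 ≤ ∑_a ∑_b conj c_a · c_b · ∫ conj (F_a (Θ U)) · F_b U dμ` (apply RP to `∑_b c_b F_b`). [folklore] -/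
theorem ReflectionPositiveOn.sum_conj_mul_integral_nonneg {μ : Measure (GaugeConfig d L G)} [IsFiniteMeasure μ]
    {Θ : GaugeConfig d L G → GaugeConfig d L G} (hΘm : Measurable Θ) {S : Set (Edge d L)}
    (h : ReflectionPositiveOn μ Θ S) {κ : Type*} [Fintype κ] (F : κ → GaugeConfig d L G → ℂ)
    (hFm : ∀ a, Measurable (F a)) (hFb : ∀ a, ∃ C : ℝ, ∀ U, ‖F a U‖ ≤ C) (hFS : ∀ a, DependsOn (F a) S)
    (c : κ → ℂ) :
    0 ≤ ∑ a, ∑ b, conj (c a) * c b * ∫ U, conj (F a (Θ U)) * F b U ∂μ := by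
  classical
  choose C hC using hFb
  set g : GaugeConfig d L G → ℂ := fun U => ∑ b, c b * F b U with hg
  have hgm : Measurable g := Finset.measurable_sum _ fun b _ => (hFm b).const_mul _
  have hgb : ∃ B : ℝ, ∀ U, ‖g U‖ ≤ B := ⟨∑ b, ‖c b‖ * C b, fun U =>
    (norm_sum_le _ _).trans (Finset.sum_le_sum fun b _ => by
      rw [norm_mul]; exact mul_le_mul_of_nonneg_left (hC b U) (norm_nonneg _))⟩
  have hgS : DependsOn g S := fun U V hUV => by
    simp only [hg]
    exact Finset.sum_congr rfl fun b _ => by rw [hFS b hUV]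
  have hpos := h g hgm hgb hgS
  -- integrability of the pairings
  have hint : ∀ a b, Integrable (fun U => conj (F a (Θ U)) * F b U) μ := fun a b =>
    Integrable.of_bound
      (((Complex.continuous_conj.measurable.comp ((hFm a).comp hΘm)).mul (hFm b)).aestronglyMeasurable)
      (C a * C b)
      (ae_of_all _ fun U => by
        rw [norm_mul, Complex.norm_conj]
        exact mul_le_mul (hC a (Θ U)) (hC b U) (norm_nonneg _) ((norm_nonneg (F a (Θ U))).trans (hC a (Θ U))))
  have hexp : (fun U => conj (g (Θ U)) * g U) =
      fun U => ∑ a, ∑ b, conj (c a) * c b * (conj (F a (Θ U)) * F b U) := by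
    funext U
    simp only [hg, map_sum, map_mul]
    rw [Finset.sum_mul]
    refine Finset.sum_congr rfl fun a _ => ?_
    rw [Finset.mul_sum]
    refine Finset.sum_congr rfl fun b _ => ?_
    ring
  rw [hexp, integral_finsetSum _ fun a _ => integrable_finsetSum _ fun b _ => (hint a b).const_mul _] at hpos
  simp_rw [integral_finsetSum _ fun b _ => (hint _ b).const_mul _, integral_const_mul] at hpos
  exact hpos

end Measure

/-! ## The blocks of a functional on complex test functions `u_a + i v_a` -/

section Blocks

variable {X : Type*} [TopologicalSpace X]

/-- **The complex RP block of a real-linear functional** `φ` for the reflection `Θ` on the complex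
test functions `F_a = u_a + i v_a`: `B_{ab} = φ((F_a∘Θ)‾ F_b)` expanded by real linearity,
`= φ((u_a∘Θ)u_b) + φ((v_a∘Θ)v_b) + i (φ((u_a∘Θ)v_b) - φ((v_a∘Θ)u_b))`. [folklore] -/
def rpBlock {κ : Type*} (φ : C(X, ℝ) →ₗ[ℝ] ℝ) (Θ : C(X, X)) (u v : κ → C(X, ℝ)) : Matrix κ κ ℂ :=
  fun a b => ((φ ((u a).comp Θ * u b) + φ ((v a).comp Θ * v b) : ℝ) : ℂ) +
    ((φ ((u a).comp Θ * v b) - φ ((v a).comp Θ * u b) : ℝ) : ℂ) * Complex.I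

end Blocks

/-! ## For a solution of the bootstrap the blocks are PSD Hermitian -/

section Unitary

open Literature.MathematicalPhysics.QuantumLattice

variable {d L : ℕ} [NeZero L] {N : ℕ} {β : ℝ}
variable {Θ : C(GaugeConfig d L (Matrix.specialUnitaryGroup (Fin N) ℂ),
  GaugeConfig d L (Matrix.specialUnitaryGroup (Fin N) ℂ))} {S : Set (Edge d L)}

/-- ★★ **Real Gram form: the cut matrices of a solution are positive semi-definite** on real vectors
(`u_j` polynomial `S`-supported test functions; Wilson measure RP for `(Θ, S)`, `Θ` polynomial-stable).
[folklore] -/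
theorem rpCutGram_nonneg_of_bootstrap_suN
    (hRP : ReflectionPositiveOn (wilsonMeasure (d := d) (L := L) (fundamentalRep (Fin N)) β) Θ S)
    (hΘpoly : ∀ f ∈ polyAlgebra (ι := Edge d L) (fundamentalLatticeRep N),
      f.comp Θ ∈ polyAlgebra (ι := Edge d L) (fundamentalLatticeRep N))
    {κ : Type*} [Fintype κ]
    {φ : C(GaugeConfig d L (Matrix.specialUnitaryGroup (Fin N) ℂ), ℝ) →ₗ[ℝ] ℝ} (h1 : φ 1 = 1)
    (hpos : ∀ a ∈ polyAlgebra (ι := Edge d L) (fundamentalLatticeRep N), 0 ≤ φ (a * a))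
    (hφ : IsSDFunctional (fundamentalLatticeRep N) (suExp N) (fun _ => wilsonAction (fundamentalRep (Fin N))) β φ)
    (u : κ → C(GaugeConfig d L (Matrix.specialUnitaryGroup (Fin N) ℂ), ℝ))
    (hu : ∀ j, u j ∈ polyAlgebra (ι := Edge d L) (fundamentalLatticeRep N))
    (huS : ∀ j, DependsOn (⇑(u j)) S) (c : κ → ℝ) :
    0 ≤ ∑ j, ∑ k, c j * c k * φ ((u j).comp Θ * u k) := by
  set g : C(GaugeConfig d L (Matrix.specialUnitaryGroup (Fin N) ℂ), ℝ) := ∑ k, c k • u k with hg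
  have hgm : g ∈ polyAlgebra (ι := Edge d L) (fundamentalLatticeRep N) :=
    Subalgebra.sum_mem _ fun k _ => Subalgebra.smul_mem _ (hu k) _
  have hgS : DependsOn (⇑g) S := by
    intro U V hUV
    simp only [hg, ContinuousMap.coe_sum, ContinuousMap.coe_smul, Finset.sum_apply, Pi.smul_apply]
    exact Finset.sum_congr rfl fun k _ => by rw [huS k hUV]
  have h := rpCut_of_bootstrap_suN hRP hΘpoly h1 hpos hφ hgm hgS
  have hexp : g.comp Θ * g = ∑ j, ∑ k, (c j * c k) • ((u j).comp Θ * u k) := by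
    rw [hg, ContinuousMap.ext_iff]
    intro U
    simp only [ContinuousMap.mul_apply, ContinuousMap.comp_apply, ContinuousMap.coe_sum, ContinuousMap.coe_smul,
      Finset.sum_apply, Pi.smul_apply, smul_eq_mul]
    rw [Finset.sum_mul]
    refine Finset.sum_congr rfl fun j _ => ?_
    rw [Finset.mul_sum]
    refine Finset.sum_congr rfl fun k _ => ?_
    ring
  rw [hexp, map_sum] at h
  simpa only [map_sum, map_smul, smul_eq_mul] using h

/-- **The block entries of a solution are the complex RP pairings of the Wilson measure**:
`rpBlock φ Θ u v a b = ∫ conj (F_a (Θ U)) · F_b U dμ_Wilson`, `F_a = u_a + i v_a`. -/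
theorem rpBlock_eq_integral_of_bootstrap_suN
    (hΘpoly : ∀ f ∈ polyAlgebra (ι := Edge d L) (fundamentalLatticeRep N),
      f.comp Θ ∈ polyAlgebra (ι := Edge d L) (fundamentalLatticeRep N))
    {κ : Type*} {φ : C(GaugeConfig d L (Matrix.specialUnitaryGroup (Fin N) ℂ), ℝ) →ₗ[ℝ] ℝ} (h1 : φ 1 = 1)
    (hpos : ∀ a ∈ polyAlgebra (ι := Edge d L) (fundamentalLatticeRep N), 0 ≤ φ (a * a))
    (hφ : IsSDFunctional (fundamentalLatticeRep N) (suExp N) (fun _ => wilsonAction (fundamentalRep (Fin N))) β φ)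
    (u v : κ → C(GaugeConfig d L (Matrix.specialUnitaryGroup (Fin N) ℂ), ℝ))
    (hu : ∀ a, u a ∈ polyAlgebra (ι := Edge d L) (fundamentalLatticeRep N))
    (hv : ∀ a, v a ∈ polyAlgebra (ι := Edge d L) (fundamentalLatticeRep N)) (a b : κ) :
    rpBlock φ Θ u v a b =
      ∫ U, conj (((u a (Θ U) : ℝ) : ℂ) + ((v a (Θ U) : ℝ) : ℂ) * Complex.I) *
        (((u b U : ℝ) : ℂ) + ((v b U : ℝ) : ℂ) * Complex.I) ∂(wilsonMeasure (fundamentalRep (Fin N)) β) := by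
  haveI : IsProbabilityMeasure (wilsonMeasure (d := d) (L := L) (fundamentalRep (Fin N)) β) :=
    isProbabilityMeasure_wilsonMeasure (ρ := fundamentalRep (Fin N)) (continuous_fundamentalRep _) β
  -- the four real pairings as integrals
  have hW : ∀ f g : C(GaugeConfig d L (Matrix.specialUnitaryGroup (Fin N) ℂ), ℝ),
      f ∈ polyAlgebra (ι := Edge d L) (fundamentalLatticeRep N) →
      g ∈ polyAlgebra (ι := Edge d L) (fundamentalLatticeRep N) →
        φ (f.comp Θ * g) = ∫ U, f (Θ U) * g U ∂(wilsonMeasure (fundamentalRep (Fin N)) β) := fun f g hf hg => by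
    rw [eq_wilson_of_bootstrap_suN N β h1 hpos hφ (Subalgebra.mul_mem _ (hΘpoly f hf) hg)]
    rfl
  have hint : ∀ f g : C(GaugeConfig d L (Matrix.specialUnitaryGroup (Fin N) ℂ), ℝ),
      Integrable (fun U => f (Θ U) * g U) (wilsonMeasure (d := d) (L := L) (fundamentalRep (Fin N)) β) := fun f g =>
    Integrable.of_bound ((f.continuous.comp Θ.continuous).mul g.continuous).measurable.aestronglyMeasurable
      (‖f‖ * ‖g‖) (ae_of_all _ fun U => by
        rw [norm_mul]
        exact mul_le_mul (f.norm_coe_le_norm _) (g.norm_coe_le_norm _) (norm_nonneg _) (norm_nonneg _))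
  have hpt : ∀ U, conj (((u a (Θ U) : ℝ) : ℂ) + ((v a (Θ U) : ℝ) : ℂ) * Complex.I) *
      (((u b U : ℝ) : ℂ) + ((v b U : ℝ) : ℂ) * Complex.I) =
      ((u a (Θ U) * u b U + v a (Θ U) * v b U : ℝ) : ℂ) +
        ((u a (Θ U) * v b U - v a (Θ U) * u b U : ℝ) : ℂ) * Complex.I := fun U => by
    simp only [map_add, map_mul, Complex.conj_ofReal, Complex.conj_I]
    push_cast
    linear_combination (-((v a (Θ U) : ℂ) * (v b U : ℂ))) * Complex.I_mul_I
  simp_rw [hpt]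
  have hAi : Integrable (fun U => ((u a (Θ U) * u b U + v a (Θ U) * v b U : ℝ) : ℂ))
      (wilsonMeasure (d := d) (L := L) (fundamentalRep (Fin N)) β) :=
    ((hint (u a) (u b)).add (hint (v a) (v b))).ofReal
  have hBi : Integrable (fun U => ((u a (Θ U) * v b U - v a (Θ U) * u b U : ℝ) : ℂ) * Complex.I)
      (wilsonMeasure (d := d) (L := L) (fundamentalRep (Fin N)) β) :=
    ((hint (u a) (v b)).sub (hint (v a) (u b))).ofReal.mul_const _
  rw [integral_add hAi hBi, integral_mul_const, integral_complex_ofReal, integral_complex_ofReal,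
    integral_add (hint (u a) (u b)) (hint (v a) (v b)), integral_sub (hint (u a) (v b)) (hint (v a) (u b)),
    rpBlock, hW (u a) (u b) (hu a) (hu b), hW (v a) (v b) (hv a) (hv b), hW (u a) (v b) (hu a) (hv b),
    hW (v a) (u b) (hv a) (hu b)]

/-- ★★★ **Complex form: the RP block of a solution is a non-negative quadratic form** —
`0 ≤ ∑_a ∑_b conj c_a · c_b · B_{ab}` for every `c ∈ ℂ^κ` (Wilson measure RP for `(Θ, S)`, `Θ`
polynomial-stable; `u_a, v_a` polynomial `S`-supported). [folklore] -/
theorem rpBlock_quadForm_nonneg_of_bootstrap_suN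
    (hRP : ReflectionPositiveOn (wilsonMeasure (d := d) (L := L) (fundamentalRep (Fin N)) β) Θ S)
    (hΘpoly : ∀ f ∈ polyAlgebra (ι := Edge d L) (fundamentalLatticeRep N),
      f.comp Θ ∈ polyAlgebra (ι := Edge d L) (fundamentalLatticeRep N))
    {κ : Type*} [Fintype κ]
    {φ : C(GaugeConfig d L (Matrix.specialUnitaryGroup (Fin N) ℂ), ℝ) →ₗ[ℝ] ℝ} (h1 : φ 1 = 1)
    (hpos : ∀ a ∈ polyAlgebra (ι := Edge d L) (fundamentalLatticeRep N), 0 ≤ φ (a * a))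
    (hφ : IsSDFunctional (fundamentalLatticeRep N) (suExp N) (fun _ => wilsonAction (fundamentalRep (Fin N))) β φ)
    (u v : κ → C(GaugeConfig d L (Matrix.specialUnitaryGroup (Fin N) ℂ), ℝ))
    (hu : ∀ a, u a ∈ polyAlgebra (ι := Edge d L) (fundamentalLatticeRep N))
    (hv : ∀ a, v a ∈ polyAlgebra (ι := Edge d L) (fundamentalLatticeRep N))
    (huS : ∀ a, DependsOn (⇑(u a)) S) (hvS : ∀ a, DependsOn (⇑(v a)) S) (c : κ → ℂ) :
    0 ≤ ∑ a, ∑ b, conj (c a) * c b * rpBlock φ Θ u v a b := by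
  haveI : IsProbabilityMeasure (wilsonMeasure (d := d) (L := L) (fundamentalRep (Fin N)) β) :=
    isProbabilityMeasure_wilsonMeasure (ρ := fundamentalRep (Fin N)) (continuous_fundamentalRep _) β
  simp_rw [rpBlock_eq_integral_of_bootstrap_suN hΘpoly h1 hpos hφ u v hu hv]
  refine hRP.sum_conj_mul_integral_nonneg Θ.continuous.measurable
    (fun a U => ((u a U : ℝ) : ℂ) + ((v a U : ℝ) : ℂ) * Complex.I) (fun a => ?_) (fun a => ?_) (fun a => ?_) c
  · exact (Complex.measurable_ofReal.comp (u a).continuous.measurable).add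
      ((Complex.measurable_ofReal.comp (v a).continuous.measurable).mul_const _)
  · refine ⟨‖u a‖ + ‖v a‖, fun U => (norm_add_le _ _).trans (add_le_add ?_ ?_)⟩
    · rw [Complex.norm_real]; exact (u a).norm_coe_le_norm U
    · rw [norm_mul, Complex.norm_I, mul_one, Complex.norm_real]; exact (v a).norm_coe_le_norm U
  · intro U V hUV
    simp only [huS a hUV, hvS a hUV]

/-- **The RP block of a solution is Hermitian** (`Θ` a `μ_W`-preserving involution:
`RPDensity.integral_comp_mul_comm`). -/
theorem rpBlock_isHermitian_of_bootstrap_suN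
    (hΘμ : MeasurePreserving Θ (wilsonMeasure (d := d) (L := L) (fundamentalRep (Fin N)) β)
      (wilsonMeasure (fundamentalRep (Fin N)) β))
    (hΘΘ : ∀ U, Θ (Θ U) = U)
    (hΘpoly : ∀ f ∈ polyAlgebra (ι := Edge d L) (fundamentalLatticeRep N),
      f.comp Θ ∈ polyAlgebra (ι := Edge d L) (fundamentalLatticeRep N))
    {κ : Type*} {φ : C(GaugeConfig d L (Matrix.specialUnitaryGroup (Fin N) ℂ), ℝ) →ₗ[ℝ] ℝ} (h1 : φ 1 = 1)
    (hpos : ∀ a ∈ polyAlgebra (ι := Edge d L) (fundamentalLatticeRep N), 0 ≤ φ (a * a))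
    (hφ : IsSDFunctional (fundamentalLatticeRep N) (suExp N) (fun _ => wilsonAction (fundamentalRep (Fin N))) β φ)
    (u v : κ → C(GaugeConfig d L (Matrix.specialUnitaryGroup (Fin N) ℂ), ℝ))
    (hu : ∀ a, u a ∈ polyAlgebra (ι := Edge d L) (fundamentalLatticeRep N))
    (hv : ∀ a, v a ∈ polyAlgebra (ι := Edge d L) (fundamentalLatticeRep N)) :
    (rpBlock φ Θ u v).IsHermitian := by
  haveI : IsProbabilityMeasure (wilsonMeasure (d := d) (L := L) (fundamentalRep (Fin N)) β) :=
    isProbabilityMeasure_wilsonMeasure (ρ := fundamentalRep (Fin N)) (continuous_fundamentalRep _) β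
  have hW : ∀ f g : C(GaugeConfig d L (Matrix.specialUnitaryGroup (Fin N) ℂ), ℝ),
      f ∈ polyAlgebra (ι := Edge d L) (fundamentalLatticeRep N) →
      g ∈ polyAlgebra (ι := Edge d L) (fundamentalLatticeRep N) →
        φ (f.comp Θ * g) = ∫ U, f (Θ U) * g U ∂(wilsonMeasure (fundamentalRep (Fin N)) β) := fun f g hf hg => by
    rw [eq_wilson_of_bootstrap_suN N β h1 hpos hφ (Subalgebra.mul_mem _ (hΘpoly f hf) hg)]
    rfl
  have hsymm : ∀ f g : C(GaugeConfig d L (Matrix.specialUnitaryGroup (Fin N) ℂ), ℝ),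
      f ∈ polyAlgebra (ι := Edge d L) (fundamentalLatticeRep N) →
      g ∈ polyAlgebra (ι := Edge d L) (fundamentalLatticeRep N) →
        φ (f.comp Θ * g) = φ (g.comp Θ * f) := fun f g hf hg => by
    rw [hW f g hf hg, hW g f hg hf]
    exact RPDensity.integral_comp_mul_comm hΘμ hΘΘ f.continuous.measurable g.continuous.measurable
  refine Matrix.IsHermitian.ext fun a b => ?_
  simp only [rpBlock, Complex.star_def, map_add, map_mul, Complex.conj_ofReal, Complex.conj_I]
  rw [hsymm (u b) (u a) (hu b) (hu a), hsymm (v b) (v a) (hv b) (hv a), hsymm (u b) (v a) (hu b) (hv a),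
    hsymm (v b) (u a) (hv b) (hu a)]
  push_cast
  ring

/-- ★★★ **THE RP BLOCKS OF A SOLUTION ARE POSITIVE SEMI-DEFINITE HERMITIAN MATRICES**
(`Matrix.PosSemidef`): `SU(N)` on `(ℤ/L)^d`, any real `β`, `Θ` a `μ_W`-preserving polynomial-stable
involution for which the Wilson measure is RP on `S`, `φ` any solution of the untruncated bootstrap,
`u_a, v_a` polynomial `S`-supported — the complex block on the test functions `u_a + i v_a` is PSD.
This is the reflection-positivity constraint exactly in the matrix form an SDP imposes. [folklore] -/
theorem rpBlock_posSemidef_of_bootstrap_suN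
    (hRP : ReflectionPositiveOn (wilsonMeasure (d := d) (L := L) (fundamentalRep (Fin N)) β) Θ S)
    (hΘμ : MeasurePreserving Θ (wilsonMeasure (d := d) (L := L) (fundamentalRep (Fin N)) β)
      (wilsonMeasure (fundamentalRep (Fin N)) β))
    (hΘΘ : ∀ U, Θ (Θ U) = U)
    (hΘpoly : ∀ f ∈ polyAlgebra (ι := Edge d L) (fundamentalLatticeRep N),
      f.comp Θ ∈ polyAlgebra (ι := Edge d L) (fundamentalLatticeRep N))
    {κ : Type*} [Fintype κ]
    {φ : C(GaugeConfig d L (Matrix.specialUnitaryGroup (Fin N) ℂ), ℝ) →ₗ[ℝ] ℝ} (h1 : φ 1 = 1)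
    (hpos : ∀ a ∈ polyAlgebra (ι := Edge d L) (fundamentalLatticeRep N), 0 ≤ φ (a * a))
    (hφ : IsSDFunctional (fundamentalLatticeRep N) (suExp N) (fun _ => wilsonAction (fundamentalRep (Fin N))) β φ)
    (u v : κ → C(GaugeConfig d L (Matrix.specialUnitaryGroup (Fin N) ℂ), ℝ))
    (hu : ∀ a, u a ∈ polyAlgebra (ι := Edge d L) (fundamentalLatticeRep N))
    (hv : ∀ a, v a ∈ polyAlgebra (ι := Edge d L) (fundamentalLatticeRep N))
    (huS : ∀ a, DependsOn (⇑(u a)) S) (hvS : ∀ a, DependsOn (⇑(v a)) S) :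
    (rpBlock φ Θ u v).PosSemidef := by
  refine Matrix.PosSemidef.of_dotProduct_mulVec_nonneg
    (rpBlock_isHermitian_of_bootstrap_suN hΘμ hΘΘ hΘpoly h1 hpos hφ u v hu hv) fun c => ?_
  have h := rpBlock_quadForm_nonneg_of_bootstrap_suN hRP hΘpoly h1 hpos hφ u v hu hv huS hvS c
  have hq : star c ⬝ᵥ (rpBlock φ Θ u v *ᵥ c) = ∑ a, ∑ b, conj (c a) * c b * rpBlock φ Θ u v a b := by
    simp only [dotProduct, Matrix.mulVec, Pi.star_apply, Complex.star_def, Finset.mul_sum]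
    exact Finset.sum_congr rfl fun a _ => Finset.sum_congr rfl fun b _ => by ring
  rw [hq]
  exact h

end Unitary

end Summit.QuantumFields.GaugeBoot

end
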